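import Summits.CriticalPhenomena.CardyFormulaZ2.Theses.CardyComplexCone
import Literature.Probability.LatticeModels.DobrushinDiscretisation
import HarnessLib

/-!
# Vocabulary of line `collar-touch-sandwich` for crux `SLESixFamiliesGiveCardy` (stmt-CriticalPhenomena-9654)

Route `CardyComplexCone` (sub-problem `CriticalPhenomena/CardyFormulaZ2`), crux
`Summit.CriticalPhenomena.CardyFormulaZ2.Theses.CardyComplexCone.SLESixFamiliesGiveCardy ≡
SLE6Families → CardyFormulaZ2` (SLE₆ for every Dobrushin domain and every admissible discretisation
family ⇒ Cardy's formula for bond percolation on `ℤ²`).  This file is the **definitions module** of the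
checked skeleton `Cruxes/SLESixFamiliesGiveCardy/Lines/collar-touch-sandwich.lean` (planner
`planner-cruxplan-stmt-CriticalPhenomena-9654-collar-touch-sandwic-0`, lead reshape r1 by
`prover-line-stmt-CriticalPhenomena-9654-0`, `ledger skeleton check` OK, 7 registered stubs): it
carries, verbatim and sorry-free, the skeleton's VOCABULARY — the two continuum interface predicates
`UpperCollarGeom R D G`, `LowerCollarGeom R D G` between the geometry stub and the lattice stubs
(what the deterministic inclusions use about an exterior-collared Dobrushin domain `D ⊇ Ω` and its
touch set `G`) and the designer-junction regularity `IsSmoothMark D i` — and the seven registered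
STUB STATEMENTS as named `Prop`s (`UpperFence`, `LowerRun`, `TouchLimsup`, `SleSideTouch`,
`CollarDomains`, `ModulusContinuity`, `SmoothMarkFamilies`), so that the stub helper files
`Theorems/CardyComplexConeSLESixFamiliesGiveCardy<Stub>.lean` (each proving
`theorem stub_<x> : <X>` by name, `--supports stmt-CriticalPhenomena-9654`) and the closing skeleton
file share ONE copy of every object.  Nothing in this file is asserted: every `def … : Prop` is a
statement to be proved by a registered stub, or a predicate; the two `theorem`s are the membership
trivialities `upperCollarGeom_touch_nonempty`, `lowerCollarGeom_touch_nonempty` (registered glue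
sub-goals: the touch sets are nonempty, the junk guard of the lattice stubs).

The line (touch-free Cardy readout): for a conformal rectangle `R = (Ω; a, b, c, d)` the free
crossing event `C_δ = discreteCrossing Ω δ (ab) (cd)` and its complement are bounded above,
deterministically and eventually in the mesh, by CLOSED range events ("the interface trace meets the
closed `η`-neighbourhood of a touch arc") of the medial exploration interfaces of two designer
Dobrushin domains `Q₁.chord 0 1`, `Q₂.chord 0 3` containing `Ω` (tube collars glued behind shortened
side arcs, marks on the outer collar boundary, outside `closure Ω`); closed-set portmanteau transports
them to SLE₆ touch probabilities, which the Rohde–Schramm same-side law at `κ = 6` evaluates as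
`F(η) + o(1)` and `1 - F(η) + o(1)`; Radó continuity of the modulus and admissible families at smooth
exterior marks complete the sandwich.  See the skeleton's module docstring for the Disproof record.
-/

noncomputable section

open Set Filter Topology Metric MeasureTheory
open scoped NNReal
open UpperHalfPlane (upperHalfPlaneSet)
open Literature.Probability Literature.Probability.RandomPlanarGeometry
  Literature.Probability.LatticeModels Literature.Probability.Percolation

namespace Summit.CriticalPhenomena.CardyFormulaZ2.Cruxes.SLESixFamiliesGiveCardy.CollarTouchSandwich

/-! ### Continuum interface predicates between the geometry stub and the lattice stubs

They isolate exactly what the two deterministic inclusions use about a collared Dobrushin domain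
`D ⊇ Ω` and its touch set `G`; STUB E constructs domains satisfying them. -/

/-- **Geometry of the UPPER readout.**  `D` is a Dobrushin domain containing the conformal
rectangle `R = (Ω; a, b, c, d)`, whose marked points lie outside `closure Ω`, whose wired arc
`D.arc 0` contains every frontier point of `Ω` near `(ab) = R.arc 0` and whose dual-wired arc
`D.arc 1` contains every frontier point of `Ω` near `(cd) = R.arc 2`, and whose closure outside
`closure Ω` stays away from `(ab) ∪ (cd)`; the touch set `G` contains `(cd)` and every point of the
dual-wired arc lying in `closure Ω` (so dual-wired lattice sites inside `Ω` are `o(1)`-close to `G`).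
Model: `D = Q₁.chord 0 1`, `G = Q₁.arc 2` of the module docstring. -/
structure UpperCollarGeom (R : ConformalRectangle) (D : DobrushinDomain) (G : Set ℂ) : Prop where
  /-- `Ω ⊆ D`. -/
  carrier_subset : R.carrier ⊆ D.carrier
  /-- The touch set contains the far arc `(cd)` (in particular it is nonempty). -/
  arc_two_subset : R.arc 2 ⊆ G
  /-- Dual-wired boundary points inside `closure Ω` belong to the touch set. -/
  arc_one_inter_closure_subset : D.arc 1 ∩ closure R.carrier ⊆ G
  /-- The two marked points of `D` lie outside `closure Ω`. -/
  pt_not_mem_closure : ∀ i : Fin 2, D.pt i ∉ closure R.carrier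
  /-- Frontier points of `Ω` near `(ab)` are wired boundary points of `D`. -/
  near_arc_zero : ∃ r : ℝ, 0 < r ∧ ∀ z ∈ frontier R.carrier, infDist z (R.arc 0) < r → z ∈ D.arc 0
  /-- Frontier points of `Ω` near `(cd)` are dual-wired boundary points of `D`. -/
  near_arc_two : ∃ r : ℝ, 0 < r ∧ ∀ z ∈ frontier R.carrier, infDist z (R.arc 2) < r → z ∈ D.arc 1
  /-- The part of `closure D` outside `closure Ω` (the collars and their outer boundaries) keeps a
  positive distance from the two arcs `(ab)`, `(cd)` read by the crossing event. -/
  closure_far : ∃ s : ℝ, 0 < s ∧ ∀ z ∈ closure D.carrier, z ∉ closure R.carrier →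
    s ≤ infDist z (R.arc 0) ∧ s ≤ infDist z (R.arc 2)

/-- **Geometry of the LOWER readout.**  `D ⊇ Ω` with marks outside `closure Ω`; the touch set `G`
contains `(da) = R.arc 3` and every point of the WIRED arc `D.arc 0` lying in `closure Ω`; and the
part of `D` outside `Ω` splits into two pieces `C₀`, `C₂` (the collars glued behind shortened
sub-arcs of `(ab)` and of `(cd)`) at distance `≥ r` from each other, `C₀` at distance `≥ r` from the
three arcs other than `(ab)`, `C₂` at distance `≥ r` from the three arcs other than `(cd)`, the mark
`D.pt 1` inside the `C₀`-collar and `D.pt 0` inside the `C₂`-collar.  Model: `D = Q₂.chord 0 3`,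
`G = Q₂.arc 1` of the module docstring. -/
structure LowerCollarGeom (R : ConformalRectangle) (D : DobrushinDomain) (G : Set ℂ) : Prop where
  /-- `Ω ⊆ D`. -/
  carrier_subset : R.carrier ⊆ D.carrier
  /-- The touch set contains the arc `(da)` (in particular it is nonempty). -/
  arc_three_subset : R.arc 3 ⊆ G
  /-- Wired boundary points inside `closure Ω` belong to the touch set. -/
  arc_zero_inter_closure_subset : D.arc 0 ∩ closure R.carrier ⊆ G
  /-- The two marked points of `D` lie outside `closure Ω`. -/
  pt_not_mem_closure : ∀ i : Fin 2, D.pt i ∉ closure R.carrier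
  /-- The exterior part of `D` splits into an `(ab)`-collar `C₀` and a `(cd)`-collar `C₂`. -/
  split : ∃ (C₀ C₂ : Set ℂ) (r : ℝ), 0 < r ∧ D.carrier \ R.carrier ⊆ C₀ ∪ C₂ ∧
    (∀ z ∈ C₀, ∀ w ∈ C₂, r ≤ dist z w) ∧
    (∀ z ∈ C₀, r ≤ infDist z (R.arc 1) ∧ r ≤ infDist z (R.arc 2) ∧ r ≤ infDist z (R.arc 3)) ∧
    (∀ z ∈ C₂, r ≤ infDist z (R.arc 0) ∧ r ≤ infDist z (R.arc 1) ∧ r ≤ infDist z (R.arc 3)) ∧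
    ball (D.pt 0) r ∩ D.carrier ⊆ C₂ ∧ ball (D.pt 1) r ∩ D.carrier ⊆ C₀

/-- **Smooth exterior mark.**  Near its `i`-th marked point the Dobrushin domain `D` is, after a
LATTICE rotation `w ↦ D.pt i + e w` (`e ∈ {1, I, -1, -I}`), the strict epigraph `{im w > g (re w)}`
of a `C²` function with `g 0 = 0` which is either in GENERAL POSITION (`0 < |g′ 0| < 1`: tangent off
the eight lattice directions) or EXACTLY affine along a lattice direction (`g = c·x`, `c ∈ {0, ±1}`).
This is the designer-junction regularity under which admissible discretisation families are a
local, monotone-staircase statement (STUB F); the collars of STUB E place their marks so. -/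
def IsSmoothMark (D : DobrushinDomain) (i : Fin 2) : Prop :=
  ∃ (e : ℂ) (g : ℝ → ℝ) (r : ℝ), (e = 1 ∨ e = Complex.I ∨ e = -1 ∨ e = -Complex.I) ∧ 0 < r ∧
    ContDiffOn ℝ 2 g (Ioo (-r) r) ∧ g 0 = 0 ∧
    ((0 < |deriv g 0| ∧ |deriv g 0| < 1) ∨ (∃ c : ℝ, (c = 0 ∨ c = 1 ∨ c = -1) ∧ ∀ t, g t = c * t)) ∧
    ∀ w : ℂ, ‖w‖ < r → (D.pt i + e * w ∈ D.carrier ↔ g w.re < w.im)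

/-! ### The seven statements of the line

Each statement is a precise `Prop`; the registered stub `stub_<x>` of the skeleton is
`theorem stub_<x> : <X>` (stated by name), proved in its own helper file. -/

/-- STATEMENT A — **the upper fence inclusion** (deterministic, eventually in the mesh): under
`UpperCollarGeom R D G`, for every discretisation family `Λ` of `D` and every `η > 0`, for all small
`δ > 0` every configuration with a free open crossing of `Ω_δ` from `(ab)_δ` to `(cd)_δ` has the
trace of its medial exploration interface in `Λ δ` within `η` of `G`. -/
def UpperFence : Prop :=
  ∀ (R : ConformalRectangle) (D : DobrushinDomain) (G : Set ℂ), UpperCollarGeom R D G →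
    ∀ (Λ : ℝ → DiscreteDobrushin), ZdDiscretisationFamily D Λ →
      ∀ η : ℝ, 0 < η → ∀ᶠ δ : ℝ in 𝓝[>] 0,
        discreteCrossing R.carrier δ (R.arc 0) (R.arc 2) ⊆
          {ω | (range (medialExplorationCurve (Λ δ) ω) ∩ cthickening η G).Nonempty}

/-- STATEMENT B — **the lower run inclusion** (deterministic, eventually in the mesh): under
`LowerCollarGeom R D G`, for every discretisation family `Λ` of `D` and every `η > 0`, for all small
`δ > 0` every configuration whose interface trace in `Λ δ` stays `η`-away from `G` has a free open
crossing of `Ω_δ` from `(ab)_δ` to `(cd)_δ`. -/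
def LowerRun : Prop :=
  ∀ (R : ConformalRectangle) (D : DobrushinDomain) (G : Set ℂ), LowerCollarGeom R D G →
    ∀ (Λ : ℝ → DiscreteDobrushin), ZdDiscretisationFamily D Λ →
      ∀ η : ℝ, 0 < η → ∀ᶠ δ : ℝ in 𝓝[>] 0,
        {ω | Disjoint (range (medialExplorationCurve (Λ δ) ω)) (cthickening η G)} ⊆
          discreteCrossing R.carrier δ (R.arc 0) (R.arc 2)

/-- STATEMENT C — **closed-set portmanteau along the mesh filter** (pure measure theory): if the
random curve classes `X δ` converge in law (`TendstoLaw`, bounded continuous test functions) to an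
a.e.-measurable `Γ` under the pre-Wiener measure and are eventually a.e.-measurable, then every
family of events eventually contained in "the trace of `X δ` meets the closed set `K`" has, for each
`ε > 0`, eventually probability at most `Law(Γ)(trace meets K) + ε`. -/
def TouchLimsup : Prop :=
  ∀ (X : ℝ → BondConfig (Site 2) → CurveClass ℂ) (Γ : (ℝ≥0 → ℝ) → CurveClass ℂ),
    AEMeasurable Γ Process.preWienerMeasure →
    (∀ᶠ δ : ℝ in 𝓝[>] 0, AEMeasurable (X δ) (bondPercolation (zdGraph 2) Percolation.half)) →
    TendstoLaw X (fun _ => bondPercolation (zdGraph 2) Percolation.half) Γ Process.preWienerMeasure →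
    ∀ (K : Set ℂ), IsClosed K → ∀ (E : ℝ → Set (BondConfig (Site 2))),
      (∀ᶠ δ : ℝ in 𝓝[>] 0, E δ ⊆ {ω | ((X δ ω).range ∩ K).Nonempty}) →
      ∀ ε : ℝ, 0 < ε → ∀ᶠ δ : ℝ in 𝓝[>] 0,
        (bondPercolation (zdGraph 2) Percolation.half).real (E δ) ≤
          (Process.preWienerMeasure.map Γ).real (CurveClass.hitsBefore K (∅ : Set ℂ)) + ε

/-- STATEMENT D — **the SLE₆ side-arc touch law** (two readings of Rohde–Schramm's same-side law at
`κ = 6`): for a conformal rectangle `Q = (p₀, p₁, p₂, p₃)` with uniformizing datum `(φ, x)`,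
(U) chordal SLE₆ in `Q.chord 0 1` (from `p₀` to `p₁`) touches the closed `η`-neighbourhood of the
far arc `Q.arc 2 = (p₂p₃)` with probability tending, as `η → 0⁺`, to `F(crossRatio x)`;
(L) chordal SLE₆ in `Q.chord 0 3` (from `p₀` to `p₃`) touches the closed `η`-neighbourhood of the
middle arc `Q.arc 1 = (p₁p₂)` of its own (long) arc `0` with probability tending to
`1 - F(crossRatio x)`.  Stated for EVERY SLE₆ random curve of the domain (no law uniqueness used). -/
def SleSideTouch : Prop :=
  ∀ (Q : ConformalRectangle) (φ : ConformalEquiv upperHalfPlaneSet Q.carrier) (x : Fin 4 → ℝ),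
    Q.IsUniformizing φ x →
    (∀ Γ : (ℝ≥0 → ℝ) → CurveClass ℂ, IsSLECurve 6 (Q.chord 0 1 (by decide)) Γ →
      Tendsto (fun η : ℝ => (Process.preWienerMeasure.map Γ).real
          (CurveClass.hitsBefore (cthickening η (Q.arc 2)) (∅ : Set ℂ)))
        (𝓝[>] 0) (𝓝 (RandomPlanarGeometry.cardyFunction (crossRatio x)))) ∧
    (∀ Γ : (ℝ≥0 → ℝ) → CurveClass ℂ, IsSLECurve 6 (Q.chord 0 3 (by decide)) Γ →
      Tendsto (fun η : ℝ => (Process.preWienerMeasure.map Γ).real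
          (CurveClass.hitsBefore (cthickening η (Q.arc 1)) (∅ : Set ℂ)))
        (𝓝[>] 0) (𝓝 (1 - RandomPlanarGeometry.cardyFunction (crossRatio x))))

/-- STATEMENT E — **exterior-collared comparison rectangles** (pure construction, lead reshape r1 of
the planner's `CollarRectangles`): for every conformal rectangle `R` and every `ε > 0` there are
(upper) a conformal rectangle `Q = (Ω₁; a⁺, b⁺, c′, d′)` with `UpperCollarGeom R (Q.chord 0 1) (Q.arc 2)`
and smooth exterior marks `a⁺, b⁺`, and (lower) a conformal rectangle `Q = (Ω₂; c⁺, d′, a′, b⁺)` with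
`LowerCollarGeom R (Q.chord 0 3) (Q.arc 1)` and smooth exterior marks `c⁺, b⁺`, each with its
boundary loop UNIFORMLY `ε`-close to the loop of `R` re-based by a shift `c`
(`dist (Q.boundary s) (R.boundary (s + c)) ≤ ε` for all `s`) and its mark parameters `ε`-close,
after the same shift, to those of `R` — for the lower rectangle to those of `R` relabelled
`(c, d, a, b)`, i.e. to `(mark 2, mark 3, mark 0 + 1, mark 1 + 1)`.  Model: tube collars of
conformal width `h → 0` glued behind shortened sub-arcs whose attaching points tend to the corners
(`ConformalTube`, `CollarDomain`), marks on plateau arcs of the outer collar boundary. -/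
def CollarDomains : Prop :=
  ∀ (R : ConformalRectangle) (ε : ℝ), 0 < ε →
    (∃ (Q : ConformalRectangle) (c : ℝ), UpperCollarGeom R (Q.chord 0 1 (by decide)) (Q.arc 2) ∧
        IsSmoothMark (Q.chord 0 1 (by decide)) 0 ∧ IsSmoothMark (Q.chord 0 1 (by decide)) 1 ∧
        (∀ s : ℝ, dist (Q.boundary s) (R.boundary (s + c)) ≤ ε) ∧
        ∀ i : Fin 4, |Q.mark i + c - R.mark i| ≤ ε) ∧
    (∃ (Q : ConformalRectangle) (c : ℝ), LowerCollarGeom R (Q.chord 0 3 (by decide)) (Q.arc 1) ∧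
        IsSmoothMark (Q.chord 0 3 (by decide)) 0 ∧ IsSmoothMark (Q.chord 0 3 (by decide)) 1 ∧
        (∀ s : ℝ, dist (Q.boundary s) (R.boundary (s + c)) ≤ ε) ∧
        |Q.mark 0 + c - R.mark 2| ≤ ε ∧ |Q.mark 1 + c - R.mark 3| ≤ ε ∧
        |Q.mark 2 + c - (R.mark 0 + 1)| ≤ ε ∧ |Q.mark 3 + c - (R.mark 1 + 1)| ≤ ε)

/-- STATEMENT G — **continuity of the conformal modulus** (Radó; lead reshape r1): for every conformal
rectangle `R` with uniformizing datum `(φ, x)` and every `θ > 0` there is `ε > 0` such that every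
conformal rectangle `Q` whose boundary loop is uniformly `ε`-close to a re-basing `s ↦ R.boundary (s + c)`
of the loop of `R`, with mark parameters `ε`-close after the same shift, has all its uniformizing data
`(φ', x')` with `|crossRatio x' - crossRatio x| ≤ θ`.  (Radó's theorem `rado_tendstoUniformlyOn_holds`
along sequences, Carathéodory injectivity on the closed disc, `cCrossRatio` continuity, argued by
contradiction for the `∃ ε`.) -/
def ModulusContinuity : Prop :=
  ∀ (R : ConformalRectangle) (φ : ConformalEquiv upperHalfPlaneSet R.carrier) (x : Fin 4 → ℝ),
    R.IsUniformizing φ x → ∀ θ : ℝ, 0 < θ → ∃ ε : ℝ, 0 < ε ∧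
      ∀ (Q : ConformalRectangle) (c : ℝ), (∀ s : ℝ, dist (Q.boundary s) (R.boundary (s + c)) ≤ ε) →
        (∀ i : Fin 4, |Q.mark i + c - R.mark i| ≤ ε) →
        ∀ (φ' : ConformalEquiv upperHalfPlaneSet Q.carrier) (x' : Fin 4 → ℝ),
          Q.IsUniformizing φ' x' → |crossRatio x' - crossRatio x| ≤ θ

/-- STATEMENT F — **admissible discretisation families at smooth exterior marks**: a Dobrushin
domain both of whose marked points are smooth marks (`IsSmoothMark`) carries a square-lattice
discretisation family (`ZdDiscretisationFamily`: domain and mesh fixed, arcs and discrete marked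
points Hausdorff-convergent, `IsZdAdmissible` for all small meshes). -/
def SmoothMarkFamilies : Prop :=
  ∀ D : DobrushinDomain, IsSmoothMark D 0 → IsSmoothMark D 1 →
    ∃ Λ : ℝ → DiscreteDobrushin, ZdDiscretisationFamily D Λ

/-! ### Glue (registered sub-goals): the touch sets are nonempty -/

/-- The touch set of the upper readout is nonempty (it contains the far arc `(cd)`, which contains
`R.pt 2`) — the junk guard answering the triage `G := ∅` probe. -/
theorem upperCollarGeom_touch_nonempty :
    ∀ {R : ConformalRectangle} {D : DobrushinDomain} {G : Set ℂ}, UpperCollarGeom R D G → G.Nonempty :=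
  fun {R} {_} {_} h ↦ ⟨R.pt 2, h.arc_two_subset (R.pt_mem_arc_self 2)⟩

/-- The touch set of the lower readout is nonempty (it contains the arc `(da)`, which contains
`R.pt 3`). -/
theorem lowerCollarGeom_touch_nonempty :
    ∀ {R : ConformalRectangle} {D : DobrushinDomain} {G : Set ℂ}, LowerCollarGeom R D G → G.Nonempty :=
  fun {R} {_} {_} h ↦ ⟨R.pt 3, h.arc_three_subset (R.pt_mem_arc_self 3)⟩

end Summit.CriticalPhenomena.CardyFormulaZ2.Cruxes.SLESixFamiliesGiveCardy.CollarTouchSandwich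

end
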